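import Summits.QuantumFields.BalabanUV.T4Continuum.Support.NE7K1LinWalkParametrix

/-!
# NE7K1LinWalkSmallness — row NE7 (node U5), candidate route HOM, path H1L, cell K1-lin(s): THE L²-SMALLNESS OF B4's REMAINDER
# `R = Σ_j K_jG_k(□_j)h_j` (p. 577 *"Lemma 2.1 implies that the L²-norm of the operator R … is small for M large enough"*) for an
# ABSTRACT finite matrix, UNIFORMLY IN THE NUMBER OF CUBES, from a FORM-BOUNDED CUT-OFF COMMUTATOR

Lineage `b2b-balaban-t4-ne7-p2` (CRUX PROVER NE7 #2), generation 68; series (RW) file 2 (vector-level L² bounds, over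
`NE7K1LinWalkParametrix`).  [Balaban1983RegularityDecay] = T. Bałaban, Commun. Math. Phys. 89 (1983) 571–597, §2 pp. 575–577.  The
content of B4's Lemma 2.1 that the smallness sentence consumes is isolated as ONE hypothesis SHAPE on the cut-off commutator,

  (H-comm)  `‖[diag(l_j), P]v‖² ≤ α²·⟨v, Pv⟩ + β²·‖v‖²`  for all `v`,

(for B4's `P = −Δ^η_A + aQ*Q` and a C² cut-off `h` varying on scale `M`: `[P,h] = −2(∇^ηh)·∇^η_A − (Δ^ηh)` up to shifts, so
`α² = O(M^{−2})` through the ENERGY and `β² = O(M^{−4}) + O(a²M^{−2})`, uniformly in the lattice spacing — B4 (2.3) and (2.15); the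
A = 0 instance is file 5 of the series), and the sentence is then PROVED:

* `diag_mulVec_sq_le`, `aPiece_mulVec_sq_le` — `‖a_j g‖² ≤ Λ²‖g‖²∕min(σ,1)²` (`|l_j| ≤ Λ`, `|r_j| ≤ 1`; B4's `‖h_jG_k(□_j)h_j‖ ≤ c₁`).
* **`bPiece_mulVec_sq_le`** — `‖b_j g‖² ≤ τ²·‖diag(r_j)g‖²`, `τ² = α²∕min(σ,1) + β²∕min(σ,1)²` (the local solution `v = G_j(r_jg)` has
  energy `⟨v,Pv⟩ ≤ ‖r_jg‖²∕min(σ,1)` and norm² `≤ ‖r_jg‖²∕min(σ,1)²` — `NE7K1LinWalkParametrix.locInv_energy_le ∕ locInv_sq_le`).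
* `bPiece_mulVec_supp`, `bPiece_mulVec_dot_eq_zero` — `b_jg` is supported in `S_j`; pieces of DISJOINT regions are orthogonal.
* **`remainder_mulVec_sq_le`** — `‖Rf‖² ≤ m·m̃·τ²·‖f‖²` where `m` bounds the number of regions `S_k` meeting a given `S_j` and `m̃` the
  number of `r_j` not vanishing at a given point: B4's *"small for M large enough"* INDEPENDENTLY OF `|Ω|`, by the tree's
  `B4RandomWalk213.norm_sum_sq_le_of_overlap` (almost-orthogonality, on `EuclideanSpace ℝ ι`) and `B4RandomWalk213.sum_overlap_le`
  (covering count) BY NAME.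

HONEST FRAMING: [folklore] finite linear algebra; (H-comm) is a hypothesis SHAPE here (B4 Lemma 2.1's L²-content), discharged at
A = 0 in file 5, NOT for Bałaban's covariant operators; nothing of Bałaban's asserted; no `sorry`.  Census only; NO letter ∕ tag ∕
size of NE7 moves; NE7 NOT PRINTED ∕ NOT PROVED; spine 0∕9; FIXED FINITE T⁴, rung (B)+1; NOT infinite volume, NOT mass gap, NOT
Clay.  HONEST DEPENDENCY: continuum YM on T⁴ ⇐ BetaPertH ∧ nine spine estimates (0/9 proved); BetaPertH ⇐ (D1) ∧ (D4) ∧ CAP+tail;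
G-an2-4 gates asym, D1 and NE2/3/4.
-/

noncomputable section

open Finset Matrix WithLp

namespace Summit.QuantumFields.BalabanUV.T4Continuum.NE7K1LinWalkSmallness

open NE7K1LinSchurLineForm NE7K1LinSchurLineDerivRel NE7K1LinInvAntitone NE7K1LinWalkParametrix
open Literature.MathematicalPhysics.QuantumFieldTheory.Balaban1983to89

variable {ι : Type*} [Fintype ι] [DecidableEq ι]

/-! ### §1 The parametrix piece `a_j` and the remainder piece `b_j`, one at a time -/

/-- a bounded diagonal contracts: `‖diag(l)w‖² ≤ Λ²‖w‖²` when `|l| ≤ Λ`. [folklore] -/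
theorem diag_mulVec_sq_le {l : ι → ℝ} {Λ : ℝ} (hl : ∀ x, |l x| ≤ Λ) (w : ι → ℝ) :
    diagonal l *ᵥ w ⬝ᵥ diagonal l *ᵥ w ≤ Λ ^ 2 * (w ⬝ᵥ w) := by
  rw [dotProduct, dotProduct, Finset.mul_sum]
  refine Finset.sum_le_sum fun x _ => ?_
  rw [mulVec_diagonal]
  have h1 : (l x) ^ 2 ≤ Λ ^ 2 := by
    have := hl x
    have hΛ : 0 ≤ Λ := (abs_nonneg _).trans this
    nlinarith [abs_nonneg (l x), sq_abs (l x)]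
  nlinarith [mul_self_nonneg (w x)]

/-- **THE PARAMETRIX PIECE IS BOUNDED**: `‖a_j g‖² ≤ Λ²·‖g‖²∕min(σ,1)²` (`|l_j| ≤ Λ`, `|r_j| ≤ 1`) — B4's `‖h_jG_k(□_j)h_j‖ ≤ c₁`
at the abstract level. [cite: Balaban1983RegularityDecay, Lemma 2.1 (2.15) p.577, shape] [folklore] -/
theorem aPiece_mulVec_sq_le (P : Matrix ι ι ℝ) {σ : ℝ} (hσ : 0 < σ) (hPc : ∀ w, σ * (w ⬝ᵥ w) ≤ w ⬝ᵥ P *ᵥ w) {l r : ι → ℝ}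
    {Λ : ℝ} (hl : ∀ x, |l x| ≤ Λ) (hr : ∀ x, |r x| ≤ 1) (S : Finset ι) (g : ι → ℝ) :
    aPiece P l r S *ᵥ g ⬝ᵥ aPiece P l r S *ᵥ g ≤ Λ ^ 2 / (min σ 1) ^ 2 * (g ⬝ᵥ g) := by
  have hσ' : 0 < min σ 1 := lt_min hσ one_pos
  simp only [aPiece, ← mulVec_mulVec]
  set h := diagonal r *ᵥ g
  set u := locInv P S *ᵥ h
  have h1 : diagonal l *ᵥ u ⬝ᵥ diagonal l *ᵥ u ≤ Λ ^ 2 * (u ⬝ᵥ u) := diag_mulVec_sq_le hl u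
  have h2 : u ⬝ᵥ u ≤ (h ⬝ᵥ h) / (min σ 1) ^ 2 := (locInv_sq_le P hσ hPc S h).2
  have h3 : h ⬝ᵥ h ≤ 1 ^ 2 * (g ⬝ᵥ g) := diag_mulVec_sq_le hr g
  have hΛ : 0 ≤ Λ ^ 2 := sq_nonneg Λ
  calc diagonal l *ᵥ u ⬝ᵥ diagonal l *ᵥ u ≤ Λ ^ 2 * (u ⬝ᵥ u) := h1
    _ ≤ Λ ^ 2 * ((g ⬝ᵥ g) / (min σ 1) ^ 2) :=
        mul_le_mul_of_nonneg_left (h2.trans (by rw [one_pow, one_mul] at h3; gcongr)) hΛ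
    _ = Λ ^ 2 / (min σ 1) ^ 2 * (g ⬝ᵥ g) := by ring

/-- a diagonal with `supp r ⊆ S` produces sources supported in `S`. [folklore] -/
theorem diag_mulVec_supp {r : ι → ℝ} {S : Finset ι} (hr : ∀ x, r x ≠ 0 → x ∈ S) (g : ι → ℝ) (x : ι) (hx : x ∉ S) :
    (diagonal r *ᵥ g) x = 0 := by
  rw [mulVec_diagonal]
  have : r x = 0 := by by_contra h; exact hx (hr x h)
  rw [this, zero_mul]

/-- **THE REMAINDER PIECE IS SMALL**: under (H-comm) `‖[diag(l),P]v‖² ≤ α²⟨v,Pv⟩ + β²‖v‖²` and `supp r ⊆ S`,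
`‖b g‖² ≤ (α²∕min(σ,1) + β²∕min(σ,1)²)·‖diag(r)g‖²` — the local solution's ENERGY carries the `α²`-part (B4: `|∇h| = O(M⁻¹)` against
`‖∇G_□‖ ≤ O(1)`), its norm the `β²`-part (`|Δh| = O(M⁻²)` against `‖G_□‖ ≤ c₁`). [cite: Balaban1983RegularityDecay, (2.11) p.576 + Lemma 2.1 (2.15) p.577, shape] [folklore] -/
theorem bPiece_mulVec_sq_le (P : Matrix ι ι ℝ) {σ : ℝ} (hσ : 0 < σ) (hPc : ∀ w, σ * (w ⬝ᵥ w) ≤ w ⬝ᵥ P *ᵥ w) {l r : ι → ℝ}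
    {S : Finset ι} (hr : ∀ x, r x ≠ 0 → x ∈ S) {α2 β2 : ℝ} (hα : 0 ≤ α2) (hβ : 0 ≤ β2)
    (hcomm : ∀ v, comm l P *ᵥ v ⬝ᵥ comm l P *ᵥ v ≤ α2 * (v ⬝ᵥ P *ᵥ v) + β2 * (v ⬝ᵥ v)) (g : ι → ℝ) :
    bPiece P l r S *ᵥ g ⬝ᵥ bPiece P l r S *ᵥ g ≤
      (α2 / min σ 1 + β2 / (min σ 1) ^ 2) * (diagonal r *ᵥ g ⬝ᵥ diagonal r *ᵥ g) := by
  have hσ' : 0 < min σ 1 := lt_min hσ one_pos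
  simp only [bPiece, ← mulVec_mulVec]
  set h := diagonal r *ᵥ g
  set u := locInv P S *ᵥ h
  have hsupp : ∀ x, x ∉ S → h x = 0 := fun x hx => diag_mulVec_supp hr g x hx
  have hen : u ⬝ᵥ P *ᵥ u ≤ (h ⬝ᵥ h) / min σ 1 := (locInv_energy_le P hσ hPc S hsupp).2
  have hno : u ⬝ᵥ u ≤ (h ⬝ᵥ h) / (min σ 1) ^ 2 := (locInv_sq_le P hσ hPc S h).2
  calc comm l P *ᵥ u ⬝ᵥ comm l P *ᵥ u ≤ α2 * (u ⬝ᵥ P *ᵥ u) + β2 * (u ⬝ᵥ u) := hcomm u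
    _ ≤ α2 * ((h ⬝ᵥ h) / min σ 1) + β2 * ((h ⬝ᵥ h) / (min σ 1) ^ 2) :=
        add_le_add (mul_le_mul_of_nonneg_left hen hα) (mul_le_mul_of_nonneg_left hno hβ)
    _ = (α2 / min σ 1 + β2 / (min σ 1) ^ 2) * (h ⬝ᵥ h) := by ring

/-- the remainder piece of a bounded family: `‖b g‖² ≤ τ²‖g‖²` (`|r| ≤ 1`). [folklore] -/
theorem bPiece_mulVec_sq_le' (P : Matrix ι ι ℝ) {σ : ℝ} (hσ : 0 < σ) (hPc : ∀ w, σ * (w ⬝ᵥ w) ≤ w ⬝ᵥ P *ᵥ w) {l r : ι → ℝ}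
    {S : Finset ι} (hr : ∀ x, r x ≠ 0 → x ∈ S) (hr1 : ∀ x, |r x| ≤ 1) {α2 β2 : ℝ} (hα : 0 ≤ α2) (hβ : 0 ≤ β2)
    (hcomm : ∀ v, comm l P *ᵥ v ⬝ᵥ comm l P *ᵥ v ≤ α2 * (v ⬝ᵥ P *ᵥ v) + β2 * (v ⬝ᵥ v)) (g : ι → ℝ) :
    bPiece P l r S *ᵥ g ⬝ᵥ bPiece P l r S *ᵥ g ≤ (α2 / min σ 1 + β2 / (min σ 1) ^ 2) * (g ⬝ᵥ g) := by
  have hσ' : 0 < min σ 1 := lt_min hσ one_pos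
  refine (bPiece_mulVec_sq_le P hσ hPc hr hα hβ hcomm g).trans (mul_le_mul_of_nonneg_left ?_ (by positivity))
  have := diag_mulVec_sq_le hr1 g
  rwa [one_pow, one_mul] at this

/-! ### §2 Supports and almost-orthogonality of the remainder pieces -/

/-- the commutator maps everything into vectors supported in `S` (its rows vanish off `S`). [folklore] -/
theorem comm_mulVec_supp {P : Matrix ι ι ℝ} {l : ι → ℝ} {S : Finset ι} (h : CutoffOn P l S) (w : ι → ℝ) (x : ι)
    (hx : x ∉ S) : (comm l P *ᵥ w) x = 0 := by
  simp only [mulVec, dotProduct]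
  exact Finset.sum_eq_zero fun y _ => by rw [comm_apply_eq_zero_of_not_mem h hx y, zero_mul]

/-- `b_j g` is supported in `S_j`. [folklore] -/
theorem bPiece_mulVec_supp {P : Matrix ι ι ℝ} {l r : ι → ℝ} {S : Finset ι} (h : CutoffOn P l S) (g : ι → ℝ) (x : ι)
    (hx : x ∉ S) : (bPiece P l r S *ᵥ g) x = 0 := by
  simp only [bPiece, ← mulVec_mulVec]
  exact comm_mulVec_supp h _ x hx

omit [DecidableEq ι] in
/-- vectors with disjoint supports are orthogonal. [folklore] -/
theorem dot_eq_zero_of_disjoint_supp {S T : Finset ι} (hST : Disjoint S T) {u w : ι → ℝ} (hu : ∀ x, x ∉ S → u x = 0)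
    (hw : ∀ x, x ∉ T → w x = 0) : u ⬝ᵥ w = 0 :=
  Finset.sum_eq_zero fun x _ => by
    by_cases hx : x ∈ S
    · rw [hw x (Finset.disjoint_left.mp hST hx), mul_zero]
    · rw [hu x hx, zero_mul]

/-- the covering count: `Σ_j ‖diag(r_j)f‖² ≤ m̃·‖f‖²` when `|r_j| ≤ 1` and at most `m̃` of the `r_j` are nonzero at any point
(`B4RandomWalk213.sum_overlap_le` BY NAME). [cite: Balaban1983RegularityDecay, (2.11)–(2.12) pp.576–577, mechanism] [folklore] -/
theorem sum_diag_mulVec_sq_le {J : Type*} [Fintype J] (r : J → ι → ℝ) (hr1 : ∀ j x, |r j x| ≤ 1) {mt : ℕ}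
    (hcover : ∀ x, (univ.filter fun j => r j x ≠ 0).card ≤ mt) (f : ι → ℝ) :
    ∑ j, (diagonal (r j) *ᵥ f ⬝ᵥ diagonal (r j) *ᵥ f) ≤ mt * (f ⬝ᵥ f) := by
  classical
  set χ : J → ι → ℕ := fun j x => if r j x ≠ 0 then 1 else 0 with hχ
  have hcov : ∀ x ∈ (univ : Finset ι), ∑ j ∈ (univ : Finset J), χ j x ≤ mt := by
    intro x _
    simp only [hχ, Finset.sum_boole, Nat.cast_id]
    exact hcover x
  have hmain := B4RandomWalk213.sum_overlap_le (univ : Finset J) (univ : Finset ι) χ (fun x => f x * f x)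
    (fun x _ => mul_self_nonneg (f x)) hcov
  refine le_trans (Finset.sum_le_sum fun j _ => ?_) (hmain.trans (le_of_eq (by rw [dotProduct])))
  rw [dotProduct]
  refine Finset.sum_le_sum fun x _ => ?_
  rw [mulVec_diagonal]
  by_cases h0 : r j x = 0
  · simp [h0, hχ]
  · have h1 : (χ j x : ℝ) = 1 := by simp [hχ, h0]
    rw [h1, one_mul]
    have := hr1 j x
    have h2 : (r j x) ^ 2 ≤ 1 := by nlinarith [abs_nonneg (r j x), sq_abs (r j x)]
    nlinarith [mul_self_nonneg (f x)]

omit [DecidableEq ι] in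
/-- `‖toLp v‖² = v·v` on `EuclideanSpace ℝ ι`. [folklore] -/
theorem norm_toLp_sq (v : ι → ℝ) : ‖(toLp 2 v : EuclideanSpace ℝ ι)‖ ^ 2 = v ⬝ᵥ v := by
  rw [← real_inner_self_eq_norm_sq, EuclideanSpace.inner_eq_star_dotProduct, star_trivial, ofLp_toLp]

omit [DecidableEq ι] in
/-- `⟪toLp v, toLp w⟫ = w·v = v·w` on `EuclideanSpace ℝ ι`. [folklore] -/
theorem inner_toLp_eq (v w : ι → ℝ) : inner ℝ (toLp 2 v : EuclideanSpace ℝ ι) (toLp 2 w : EuclideanSpace ℝ ι) = v ⬝ᵥ w := by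
  rw [EuclideanSpace.inner_eq_star_dotProduct, star_trivial, dotProduct_comm, ofLp_toLp, ofLp_toLp]

/-- **ALMOST-ORTHOGONALITY** in `dotProduct` currency: vectors `u_j` supported in regions `S_j`, each region meeting at most `m`
regions, have `‖Σ_j u_j‖² ≤ m·Σ_j‖u_j‖²` (`B4RandomWalk213.norm_sum_sq_le_of_overlap` BY NAME on `EuclideanSpace ℝ ι`).
[cite: Balaban1983RegularityDecay, (2.11)–(2.12) pp.576–577, mechanism] [folklore] -/
theorem sum_dot_sum_le_of_overlap {J : Type*} [Fintype J] [DecidableEq J] (S : J → Finset ι) (u : J → ι → ℝ)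
    (hu : ∀ j x, x ∉ S j → u j x = 0) {m : ℕ} (hm : ∀ j, (univ.filter fun k => ¬ Disjoint (S j) (S k)).card ≤ m) :
    (∑ j, u j) ⬝ᵥ (∑ j, u j) ≤ m * ∑ j, (u j ⬝ᵥ u j) := by
  classical
  set U : J → EuclideanSpace ℝ ι := fun j => toLp 2 (u j) with hU
  have horth : ∀ j ∈ (univ : Finset J), ∀ k ∈ (univ : Finset J), ¬ (¬ Disjoint (S j) (S k)) → inner ℝ (U j) (U k) = 0 := by
    intro j _ k _ hjk
    rw [not_not] at hjk
    rw [hU, inner_toLp_eq]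
    exact dot_eq_zero_of_disjoint_supp hjk (hu j) (hu k)
  have h := B4RandomWalk213.norm_sum_sq_le_of_overlap (𝕜 := ℝ) (univ : Finset J) (fun j k => ¬ Disjoint (S j) (S k))
    (fun j k hjk => by rwa [disjoint_comm]) U horth (m := m) (fun j _ => hm j)
  have h1 : ‖∑ j, U j‖ ^ 2 = (∑ j, u j) ⬝ᵥ (∑ j, u j) := by
    rw [hU, ← toLp_sum, norm_toLp_sq]
  have h2 : ∑ j, ‖U j‖ ^ 2 = ∑ j, (u j ⬝ᵥ u j) := Finset.sum_congr rfl fun j _ => by rw [hU, norm_toLp_sq]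
  rw [h1, h2] at h
  exact h

/-! ### §3 The remainder is small, uniformly in the number of regions -/

/-- **B4 p. 577, THE SMALLNESS OF `R` IN KERNEL (abstract form)**: for a `σ`-coercive `P`, a finite family of cut-off triples
`(l_j, r_j, S_j)` with `l_j` living on `S_j` for `P`, `supp r_j ⊆ S_j`, `|r_j| ≤ 1`, (H-comm) with constants `(α², β²)` for
every `j`, every region meeting at most `m` regions and at most `m̃` of the `r_j` nonzero at any point:
`‖R f‖² ≤ m·m̃·(α²∕min(σ,1) + β²∕min(σ,1)²)·‖f‖²` for `R = Σ_j [diag(l_j),P]·G_j·diag(r_j)` — *"the L²-norm of the operator R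
given by (2.11) is small for M large enough"*, independently of the number of cubes (i.e. of `|Ω|`). [cite: Balaban1983RegularityDecay, p.577 after (2.12)] [folklore] -/
theorem remainder_mulVec_sq_le {J : Type*} [Fintype J] [DecidableEq J] (P : Matrix ι ι ℝ) {σ : ℝ} (hσ : 0 < σ)
    (hPc : ∀ w, σ * (w ⬝ᵥ w) ≤ w ⬝ᵥ P *ᵥ w) (l r : J → ι → ℝ) (S : J → Finset ι)
    (hcut : ∀ j, CutoffOn P (l j) (S j)) (hr : ∀ j x, r j x ≠ 0 → x ∈ S j) (hr1 : ∀ j x, |r j x| ≤ 1)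
    {α2 β2 : ℝ} (hα : 0 ≤ α2) (hβ : 0 ≤ β2)
    (hcomm : ∀ j v, comm (l j) P *ᵥ v ⬝ᵥ comm (l j) P *ᵥ v ≤ α2 * (v ⬝ᵥ P *ᵥ v) + β2 * (v ⬝ᵥ v))
    {m mt : ℕ} (hm : ∀ j, (univ.filter fun k => ¬ Disjoint (S j) (S k)).card ≤ m)
    (hcover : ∀ x, (univ.filter fun j => r j x ≠ 0).card ≤ mt) (f : ι → ℝ) :
    (∑ j, bPiece P (l j) (r j) (S j)) *ᵥ f ⬝ᵥ (∑ j, bPiece P (l j) (r j) (S j)) *ᵥ f ≤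
      m * mt * (α2 / min σ 1 + β2 / (min σ 1) ^ 2) * (f ⬝ᵥ f) := by
  have hσ' : 0 < min σ 1 := lt_min hσ one_pos
  set τ2 := α2 / min σ 1 + β2 / (min σ 1) ^ 2 with hτ
  have hτ0 : 0 ≤ τ2 := by positivity
  rw [sum_mulVec]
  have h1 := sum_dot_sum_le_of_overlap S (fun j => bPiece P (l j) (r j) (S j) *ᵥ f)
    (fun j x hx => bPiece_mulVec_supp (hcut j) f x hx) hm
  have h2 : ∑ j, (bPiece P (l j) (r j) (S j) *ᵥ f ⬝ᵥ bPiece P (l j) (r j) (S j) *ᵥ f) ≤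
      τ2 * ∑ j, (diagonal (r j) *ᵥ f ⬝ᵥ diagonal (r j) *ᵥ f) := by
    rw [Finset.mul_sum]
    exact Finset.sum_le_sum fun j _ => bPiece_mulVec_sq_le P hσ hPc (hr j) hα hβ (hcomm j) f
  have h3 := sum_diag_mulVec_sq_le r hr1 hcover f
  calc (∑ j, bPiece P (l j) (r j) (S j) *ᵥ f) ⬝ᵥ (∑ j, bPiece P (l j) (r j) (S j) *ᵥ f)
      ≤ m * ∑ j, (bPiece P (l j) (r j) (S j) *ᵥ f ⬝ᵥ bPiece P (l j) (r j) (S j) *ᵥ f) := h1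
    _ ≤ m * (τ2 * (mt * (f ⬝ᵥ f))) := by
        refine mul_le_mul_of_nonneg_left (h2.trans (mul_le_mul_of_nonneg_left h3 hτ0)) (Nat.cast_nonneg m)
    _ = m * mt * τ2 * (f ⬝ᵥ f) := by ring

end Summit.QuantumFields.BalabanUV.T4Continuum.NE7K1LinWalkSmallness

end
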